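import Literature.Geometry.Kaehler.ComplexTorusComplementaryMultidegrees
import HarnessLib

/-!
# Complementary multidegrees, the Corollary for the abelian subvarieties themselves:
# `deg_J(B)/r₁!⋯r_n! = deg_{J′}(B^⊥)/r′₁!⋯r′_n!` (Bertrand 1997, §3 (b)) — rider to `ComplexTorusComplementaryMultidegrees`

Layer `Literature/Geometry/Kaehler`, namespace `Literature.Geometry.Kaehler.ComplexTorus`; lane `lit-hodgefound`
(Track 2 foundations library, Layer A4), prover seat p09 (gen 15; rider to row g15-#1).  Theorems only.

`ComplexTorusComplementaryMultidegrees.lean` proves Bertrand's Corollary ON FORMS, for every integral cycle: for a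
principally polarised torus `X = E/ΦΛ` with a symplectic basis `e₀` whose pairs are split into blocks by
`blk : Fin g → β` (block forms `θ_i = blockTwoForm`, `ch_i = -θ_i = c₁(p_i^*L_i)` in the product case), complementary
words `c : Fin q → β`, `c′ : Fin p → β` (`r_i(c) + r_i(c′) = #blk⁻¹ i`, `q + p = g`) and every `σ ∈ H_{2q}(X, ℤ)`,
`J! · ∫_X ch^{J′} ∧ η♭(σ) = J′! · ∫_σ ch^{J}` (`IsSymplecticEnum.prod_factorial_mul_torusIntegral_chern_wedge_polFlat_of_principal`).
Its header lists as "not here" the reading for the abelian subvarieties themselves, `σ = [B]`; this file supplies it,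
in the language of `ComplexTorusSubtorusDegree` / `ComplexTorusComplementarySubtorusDegrees` (p10), where the degree of
a sub-torus presented by a subtorus datum `W′ : SubtorusFrame Φ (2r)` against `2r`-forms `x` is the intersection number
`∫_X x ∧ cl(W′) = torusIntegral Φ e (x.wedge (W′.cycleForm e))`:

Source, verbatim (D. Bertrand, *Duality on tori and multiplicative dependence relations*, J. Austral. Math. Soc. A
**62** (1997), §3 (b), p. 214, held text `paper:doi-10-1017-s1446788700000768` chunk p0017 L26–L29):
"COROLLARY. Let `(A, λ) = ∏_{i=1}^n (C_i, λ_i)` be a principally polarized abelian variety, let `B`, `B^⊥` be a pair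
of orthogonal abelian subvarieties with respect to `λ`, of dimension `b`, `b′ = a - b`, and let `J`, `J′` be
complementary sets of indices as above. Then, `deg_J(B)/r₁!⋯r_n! = deg_{J′}(B^⊥)/r′₁!⋯r′_n!`."  with
"`deg_J(W) = (W · p₁^*λ₁^{r₁} ⋯ p_n^*λ_n^{r_n})`" (p. 213).

* `IsSymplecticEnum.prod_factorial_mul_torusIntegral_chern_wedge_cycleForm_orthSubspace`: for a complex sub-torus
  `B = π(V)` (`IsLatticeSubspace V`, `IsComplexSubspace Φ V`) presented by a subtorus datum `Y′ : SubtorusFrame Φ (2q)`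
  (`Y′.realSpan = ΦV`) and `B^⊥ = π(V^⊥)` presented by `Z′ : SubtorusFrame Φ (2p)` (`Z′.realSpan = ΦV^⊥`,
  `V^⊥ = orthSubspace Φ η V`):  **`J! · ∫_X ch^{J′} ∧ cl(B^⊥) = J′! · ∫_X ch^{J} ∧ cl(B)`** — the form identity at
  `σ = [B] = ιMulti(Y′.frame)`, with `η♭([B]) = cl(B^⊥)` (gen 11's `IsPrincipalPolarization.cycleForm_eq_polFlat_of_realSpan_eq`,
  `ComplexTorusComplementarySubtorusClassDuality`) and `∫_{[B]} ch^J = ch^J(ΦY′) = ∫_X ch^J ∧ cl(B)` (`cycleIntegral_ιMulti`,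
  `SubtorusFrame.torusIntegral_wedge_cycleForm`);
* `IsSymplecticEnum.torusIntegral_chern_wedge_cycleForm_div_eq_orthSubspace`: the printed quotient form
  **`deg_J(B)/r₁!⋯r_n! = deg_{J′}(B^⊥)/r′₁!⋯r′_n!`**.

No definition, no named fact (net debt 0).

## References

* [Bertrand1997DualityTori] D. Bertrand, *Duality on tori and multiplicative dependence relations*, J. Austral.
  Math. Soc. Ser. A 62 (1997) 198–216, doi:10.1017/S1446788700000768, §3 (b) Corollary, p. 214.
* [Lange2023AbelianVarietiesComplex] H. Lange, *Abelian Varieties over the Complex Numbers*, Springer (2023), §2.5.3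
  Lemma 2.5.12 / 2.5.14 (integration over Pontryagin monomials, Poincaré duality), §6.2.1 (cycle classes).
-/

noncomputable section

open Module Function Finset

namespace Literature.Geometry.Kaehler

namespace ComplexTorus

universe uE

variable {ι : Type*} [Fintype ι] [LinearOrder ι] {E : Type uE} [NormedAddCommGroup E] [NormedSpace ℂ E]
  (Φ : (ι → ℝ) ≃L[ℝ] E) {g : ℕ} {e₀ : Fin g ⊕ Fin g ≃ ι} {η : E [⋀^Fin 2]→L[ℝ] ℝ} {d : Fin g → ℕ}
  {β : Type*} [Fintype β] [DecidableEq β] {p q : ℕ} {V : Submodule ℝ (ι → ℝ)}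

/-- **Bertrand's COROLLARY (§3 (b), p. 214) for a pair of orthogonal abelian subvarieties `B`, `B^⊥` of a
principally polarised torus with a symplectic basis split into blocks: `J! · deg_{J′}(B^⊥) = J′! · deg_J(B)`**, the
degrees being the intersection numbers `deg_J(W) = ∫_X ch^{J} ∧ cl(W)` (`ch_i = -θ_i`, `cl(W)` the cycle class of a
subtorus datum presenting `W`): the identity on forms `J! ∫_X ch^{J′} ∧ η♭(σ) = J′! ∫_σ ch^{J}`
(`IsSymplecticEnum.prod_factorial_mul_torusIntegral_chern_wedge_polFlat_of_principal`) at `σ = [B]`, where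
`η♭([B]) = cl(B^⊥)` (`IsPrincipalPolarization.cycleForm_eq_polFlat_of_realSpan_eq`) and `∫_{[B]} ch^J = ∫_X ch^J ∧ cl(B)`.
[cite: Bertrand1997DualityTori, §3 (b) Corollary, p. 214] -/
theorem IsSymplecticEnum.prod_factorial_mul_torusIntegral_chern_wedge_cycleForm_orthSubspace
    (hs : IsSymplecticEnum Φ e₀ η d) (hpp : IsPrincipalPolarization Φ η) (hm : q + p = g)
    (blk : Fin g → β) {c : Fin q → β} {c' : Fin p → β}
    (hcc' : ∀ i, wordMult c i + wordMult c' i = (univ.filter fun ν ↦ blk ν = i).card)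
    (hV : IsLatticeSubspace V) (hVc : IsComplexSubspace Φ V) (Y' : SubtorusFrame Φ (2 * q))
    (hY' : Y'.realSpan = V.map (Φ : (ι → ℝ) →ₗ[ℝ] E)) (Z' : SubtorusFrame Φ (2 * p))
    (hZ' : Z'.realSpan = (orthSubspace Φ η V).map (Φ : (ι → ℝ) →ₗ[ℝ] E)) (e : Fin (2 * p + 2 * q) ≃ ι)
    (e' : Fin (2 * q + 2 * p) ≃ ι) :
    (∏ i, ((wordMult c i).factorial : ℂ)) *
        torusIntegral Φ e ((wedgeFamily p fun j ↦ -blockTwoForm Φ e₀ d blk (c' j)).wedge (Z'.cycleForm e)) =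
      (∏ i, ((wordMult c' i).factorial : ℂ)) *
        torusIntegral Φ e' ((wedgeFamily q fun j ↦ -blockTwoForm Φ e₀ d blk (c j)).wedge (Y'.cycleForm e')) := by
  obtain ⟨G, hG⟩ := exists_intMatrix_latticeGram Φ η hpp.isRiemannForm.2.1
  have hm' : q + p = Fintype.card (Fin g) := by rw [Fintype.card_fin]; exact hm
  rw [hpp.cycleForm_eq_polFlat_of_realSpan_eq Φ hV hVc Y' hY' Z' hZ' e,
    hs.prod_factorial_mul_torusIntegral_chern_wedge_polFlat_of_principal Φ hpp hG hm' e blk hcc',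
    cycleIntegral_ιMulti, SubtorusFrame.torusIntegral_wedge_cycleForm]

/-- **Bertrand's COROLLARY as printed: `deg_J(B)/r₁!⋯r_n! = deg_{J′}(B^⊥)/r′₁!⋯r′_n!`** (`rᵢ = #{j ∣ c j = i}`,
`r′ᵢ = #{j ∣ c′ j = i}`, `rᵢ + r′ᵢ = cᵢ` the size of block `i`).
[cite: Bertrand1997DualityTori, §3 (b) Corollary, p. 214] -/
theorem IsSymplecticEnum.torusIntegral_chern_wedge_cycleForm_div_eq_orthSubspace
    (hs : IsSymplecticEnum Φ e₀ η d) (hpp : IsPrincipalPolarization Φ η) (hm : q + p = g)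
    (blk : Fin g → β) {c : Fin q → β} {c' : Fin p → β}
    (hcc' : ∀ i, wordMult c i + wordMult c' i = (univ.filter fun ν ↦ blk ν = i).card)
    (hV : IsLatticeSubspace V) (hVc : IsComplexSubspace Φ V) (Y' : SubtorusFrame Φ (2 * q))
    (hY' : Y'.realSpan = V.map (Φ : (ι → ℝ) →ₗ[ℝ] E)) (Z' : SubtorusFrame Φ (2 * p))
    (hZ' : Z'.realSpan = (orthSubspace Φ η V).map (Φ : (ι → ℝ) →ₗ[ℝ] E)) (e : Fin (2 * p + 2 * q) ≃ ι)
    (e' : Fin (2 * q + 2 * p) ≃ ι) :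
    torusIntegral Φ e' ((wedgeFamily q fun j ↦ -blockTwoForm Φ e₀ d blk (c j)).wedge (Y'.cycleForm e')) /
        (∏ i, ((wordMult c i).factorial : ℂ)) =
      torusIntegral Φ e ((wedgeFamily p fun j ↦ -blockTwoForm Φ e₀ d blk (c' j)).wedge (Z'.cycleForm e)) /
        (∏ i, ((wordMult c' i).factorial : ℂ)) := by
  have hfc : (∏ i, ((wordMult c i).factorial : ℂ)) ≠ 0 :=
    Finset.prod_ne_zero_iff.2 fun i _ ↦ by exact_mod_cast (Nat.factorial_pos _).ne'
  have hfc' : (∏ i, ((wordMult c' i).factorial : ℂ)) ≠ 0 :=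
    Finset.prod_ne_zero_iff.2 fun i _ ↦ by exact_mod_cast (Nat.factorial_pos _).ne'
  rw [div_eq_div_iff hfc hfc', mul_comm,
    ← hs.prod_factorial_mul_torusIntegral_chern_wedge_cycleForm_orthSubspace Φ hpp hm blk hcc' hV hVc Y' hY' Z' hZ' e e',
    mul_comm]

end ComplexTorus

end Literature.Geometry.Kaehler
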